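import Mathlib
import HarnessLib
import Literature.NumberTheory.Sieve.CircleMethod

/-!
# Support lemmas for `stub_mbb_of_boxInputs` (line `Sketch`, crux `SplitBlockJacobiCorner`,
# stmt-Parity-15002): Vaughan's identity in explicit divisor-sum form, and the generic expansion
# of a convolution against a weight

Kernel-free.  With one parameter `U` (`= V`), the truncations `μ_{≤U}`, `μ_{>U} = μ − μ_{≤U}`,
`Λ_{≤U}` and

* `λ_U(r) := Σ_{c ∣ r, c > U} Λ(c) = ((Λ − Λ_{≤U}) * 1)(r) ∈ [0, log r]`,
* `c₀(d) := Σ_{bc = d} μ_{≤U}(b) Λ_{≤U}(c)` (`|c₀(d)| ≤ log d`, supported on `d ≤ U²`),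
* `Λ_I(n) := Σ_{d ∣ n} (μ_{≤U}(d) log(n/d) − c₀(d))` (Type I part),
* `Λ_II(n) := Σ_{br = n} μ_{>U}(b) λ_U(r)` (Type II part: BOTH coefficients `μ`, `λ_U/log` are
  unit-bounded — no divisor function — because the free variable of Vaughan's bilinear term is
  grouped with `Λ_{>U}`),

the tree's `Literature.NumberTheory.Sieve.vaughan_identity_holds` reads `Λ(n) = Λ_I(n) + Λ_II(n)`
for `n > U` (`vonMangoldt_eq_typeI_add_typeII`).  The expressions are written out in full (no new
definitions).  `sum_antidiagonal_mul_eq` is the generic rearrangement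
`Σ_{Q ∈ (P,t], Q ≡ 1 (4)} (Σ_{dn = Q} ψ(d,n)) F(Q) = Σ_{d,n ≤ t} [P < dn ≤ t, dn ≡ 1 (4)] ψ(d,n) F(dn)`.
-/

noncomputable section

open Finset ArithmeticFunction
open scoped ArithmeticFunction.Moebius ArithmeticFunction.zeta

namespace Summit.Parity.BatemanHorn.Cruxes.SplitBlockJacobiCorner.Sketch.MbbOfBoxInputs

/-! ### Vaughan's identity, explicit form -/

/-- Pointwise subtraction of real arithmetic functions. [folklore] -/
theorem arith_sub_apply (f g : ArithmeticFunction ℝ) (n : ℕ) : (f - g) n = f n - g n := by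
  rw [sub_eq_add_neg, ArithmeticFunction.add_apply, ArithmeticFunction.neg_apply, sub_eq_add_neg]

/-- `μ_{≤U}` coerced to `ℝ`, pointwise. [folklore] -/
theorem moebiusTrunc_real_apply (U n : ℕ) :
    ((Literature.NumberTheory.Sieve.moebiusTrunc U : ArithmeticFunction ℤ) : ArithmeticFunction ℝ) n =
      (if n ≤ U then (((μ n : ℤ)) : ℝ) else 0) := by
  rw [ArithmeticFunction.intCoe_apply, Literature.NumberTheory.Sieve.moebiusTrunc_apply]
  push_cast
  rfl

/-- `λ_U(r) = ((Λ − Λ_{≤U}) * ζ)(r) = Σ_{c ∣ r, c > U} Λ(c)`. [folklore] -/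
theorem lamU_eq (U r : ℕ) :
    ((Λ - Literature.NumberTheory.Sieve.vonMangoldtTrunc U) * (ζ : ArithmeticFunction ℝ)) r =
      (∑ c ∈ Nat.divisors r, if U < c then Λ c else 0) := by
  rw [ArithmeticFunction.coe_mul_zeta_apply]
  refine Finset.sum_congr rfl fun c _ => ?_
  rw [arith_sub_apply, Literature.NumberTheory.Sieve.vonMangoldtTrunc_apply]
  by_cases h : c ≤ U
  · rw [if_pos h, if_neg (not_lt.mpr h), sub_self]
  · rw [if_neg h, if_pos (not_le.mp h), sub_zero]

/-- **Vaughan's identity, explicit form**: for `n > U`, `Λ(n) = Λ_I(n) + Λ_II(n)` with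
`Λ_I(n) = Σ_{d ∣ n} (μ_{≤U}(d) log(n/d) − c₀(d))`, `Λ_II(n) = Σ_{br = n} μ_{>U}(b) λ_U(r)`
(from the tree's `vaughan_identity_holds` with `U = V`, Iwaniec–Kowalski (13.39)). [folklore] -/
theorem vonMangoldt_eq_typeI_add_typeII (U n : ℕ) (hn : U < n) :
    Λ n = (∑ d ∈ Nat.divisors n, ((if d ≤ U then (((μ d : ℤ)) : ℝ) else 0) * Real.log (((n / d : ℕ)) : ℝ) - (∑ y ∈ Nat.divisorsAntidiagonal d, (if y.1 ≤ U then (((μ y.1 : ℤ)) : ℝ) else 0) * (if y.2 ≤ U then Λ y.2 else 0)))) + (∑ y ∈ Nat.divisorsAntidiagonal n, (if U < y.1 then (((μ y.1 : ℤ)) : ℝ) else 0) * (∑ c ∈ Nat.divisors y.2, if U < c then Λ c else 0)) := by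
  have hV := Literature.NumberTheory.Sieve.vaughan_identity_holds U U n hn
  rw [hV]
  set μU : ArithmeticFunction ℝ :=
    ((Literature.NumberTheory.Sieve.moebiusTrunc U : ArithmeticFunction ℤ) : ArithmeticFunction ℝ)
    with hμU
  set ΛV : ArithmeticFunction ℝ := Literature.NumberTheory.Sieve.vonMangoldtTrunc U with hΛV
  -- first term: `(μ_{≤U} * log)(n) = Σ_{d ∣ n} μ_{≤U}(d) log(n/d)`
  have h1 : (μU * ArithmeticFunction.log) n = ∑ d ∈ Nat.divisors n, (if d ≤ U then (((μ d : ℤ)) : ℝ) else 0) * Real.log (((n / d : ℕ)) : ℝ) := by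
    rw [ArithmeticFunction.mul_apply, Nat.sum_divisorsAntidiagonal (fun a b => μU a * ArithmeticFunction.log b)]
    refine Finset.sum_congr rfl fun d _ => ?_
    rw [hμU, moebiusTrunc_real_apply, ArithmeticFunction.log_apply]
  -- second term: `(μ_{≤U} * Λ_{≤U} * ζ)(n) = Σ_{d ∣ n} c₀(d)`
  have h2 : (μU * ΛV * (ζ : ArithmeticFunction ℝ)) n = ∑ d ∈ Nat.divisors n, (∑ y ∈ Nat.divisorsAntidiagonal d, (if y.1 ≤ U then (((μ y.1 : ℤ)) : ℝ) else 0) * (if y.2 ≤ U then Λ y.2 else 0)) := by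
    rw [ArithmeticFunction.coe_mul_zeta_apply]
    refine Finset.sum_congr rfl fun d _ => ?_
    rw [ArithmeticFunction.mul_apply]
    refine Finset.sum_congr rfl fun y _ => ?_
    rw [hμU, moebiusTrunc_real_apply, hΛV, Literature.NumberTheory.Sieve.vonMangoldtTrunc_apply]
  -- third term: `((μ − μ_{≤U}) * ((Λ − Λ_{≤U}) * ζ))(n) = Σ_{br = n} μ_{>U}(b) λ_U(r)`
  have h3 : (((μ : ArithmeticFunction ℝ) - μU) * (Λ - ΛV) * (ζ : ArithmeticFunction ℝ)) n = (∑ y ∈ Nat.divisorsAntidiagonal n, (if U < y.1 then (((μ y.1 : ℤ)) : ℝ) else 0) * (∑ c ∈ Nat.divisors y.2, if U < c then Λ c else 0)) := by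
    rw [mul_assoc, ArithmeticFunction.mul_apply]
    refine Finset.sum_congr rfl fun y _ => ?_
    rw [hΛV, lamU_eq, arith_sub_apply, hμU, moebiusTrunc_real_apply, ArithmeticFunction.intCoe_apply]
    congr 1
    by_cases h : y.1 ≤ U
    · rw [if_pos h, if_neg (not_lt.mpr h), sub_self]
    · rw [if_neg h, if_pos (not_le.mp h), sub_zero]
  rw [h1, h2, h3, ← Finset.sum_sub_distrib]

/-! ### Bounds for the coefficients -/

/-- `0 ≤ λ_U(r)`. [folklore] -/
theorem lamU_nonneg (U r : ℕ) : 0 ≤ (∑ c ∈ Nat.divisors r, if U < c then Λ c else 0) :=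
  Finset.sum_nonneg fun c _ => by split_ifs <;> [exact vonMangoldt_nonneg; exact le_rfl]

/-- `λ_U(r) ≤ log r`. [folklore] -/
theorem lamU_le_log (U r : ℕ) : (∑ c ∈ Nat.divisors r, if U < c then Λ c else 0) ≤ Real.log r := by
  rw [← vonMangoldt_sum]
  exact Finset.sum_le_sum fun c _ => by split_ifs <;> [exact le_rfl; exact vonMangoldt_nonneg]

/-- `λ_U(r) = 0` for `r ≤ U`. [folklore] -/
theorem lamU_eq_zero_of_le {U r : ℕ} (hr : r ≤ U) : (∑ c ∈ Nat.divisors r, if U < c then Λ c else 0) = 0 := by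
  refine Finset.sum_eq_zero fun c hc => ?_
  have hcr : c ≤ r := Nat.divisor_le hc
  rw [if_neg (by omega)]

/-- `|c₀(d)| ≤ log d`. [folklore] -/
theorem abs_c0_le_log (U d : ℕ) : |(∑ y ∈ Nat.divisorsAntidiagonal d, (if y.1 ≤ U then (((μ y.1 : ℤ)) : ℝ) else 0) * (if y.2 ≤ U then Λ y.2 else 0))| ≤ Real.log d := by
  refine (Finset.abs_sum_le_sum_abs _ _).trans ?_
  rw [← vonMangoldt_sum, ← Nat.sum_divisorsAntidiagonal' (fun _ b => Λ b)]
  refine Finset.sum_le_sum fun y _ => ?_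
  rw [abs_mul]
  have hμ : |(if y.1 ≤ U then (((μ y.1 : ℤ)) : ℝ) else 0)| ≤ 1 := by
    split_ifs
    · exact_mod_cast abs_moebius_le_one
    · simp
  have hΛ : |(if y.2 ≤ U then Λ y.2 else 0)| ≤ Λ y.2 := by
    split_ifs
    · exact (abs_of_nonneg vonMangoldt_nonneg).le
    · rw [abs_zero]; exact vonMangoldt_nonneg
  calc _ ≤ 1 * Λ y.2 := mul_le_mul hμ hΛ (abs_nonneg _) zero_le_one
    _ = Λ y.2 := one_mul _

/-- `c₀(d) = 0` unless `d ≤ U²`. [folklore] -/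
theorem c0_eq_zero_of_lt {U d : ℕ} (hd : U * U < d) : (∑ y ∈ Nat.divisorsAntidiagonal d, (if y.1 ≤ U then (((μ y.1 : ℤ)) : ℝ) else 0) * (if y.2 ≤ U then Λ y.2 else 0)) = 0 := by
  refine Finset.sum_eq_zero fun y hy => ?_
  have hy' := (Nat.mem_divisorsAntidiagonal.mp hy).1
  by_cases h1 : y.1 ≤ U
  · by_cases h2 : y.2 ≤ U
    · exfalso
      have : y.1 * y.2 ≤ U * U := Nat.mul_le_mul h1 h2
      omega
    · rw [if_neg h2, mul_zero]
  · rw [if_neg h1, zero_mul]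

/-- The Type I weight `w(d, n) = μ_{≤U}(d) log n − c₀(d)` has `|w(d,n)| ≤ log n + log d`
(`n, d ≥ 1`). [folklore] -/
theorem abs_typeI_weight_le (U d n : ℕ) (hn : 1 ≤ n) :
    |((if d ≤ U then (((μ d : ℤ)) : ℝ) else 0) * Real.log ((n : ℕ) : ℝ) - (∑ y ∈ Nat.divisorsAntidiagonal d, (if y.1 ≤ U then (((μ y.1 : ℤ)) : ℝ) else 0) * (if y.2 ≤ U then Λ y.2 else 0)))| ≤ Real.log n + Real.log d := by
  refine (abs_sub _ _).trans (add_le_add ?_ (abs_c0_le_log U d))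
  rw [abs_mul]
  have hμ : |(if d ≤ U then (((μ d : ℤ)) : ℝ) else 0)| ≤ 1 := by
    split_ifs
    · exact_mod_cast abs_moebius_le_one
    · simp
  have hlog : 0 ≤ Real.log n := Real.log_nonneg (by exact_mod_cast hn)
  calc _ ≤ 1 * |Real.log n| := mul_le_mul_of_nonneg_right hμ (abs_nonneg _)
    _ = Real.log n := by rw [one_mul, abs_of_nonneg hlog]

/-- The Type I weight vanishes unless `d ≤ U²` (given `1 ≤ U`). [folklore] -/
theorem typeI_weight_eq_zero_of_lt {U d : ℕ} (hU : 1 ≤ U) (hd : U * U < d) (n : ℕ) :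
    ((if d ≤ U then (((μ d : ℤ)) : ℝ) else 0) * Real.log ((n : ℕ) : ℝ) - (∑ y ∈ Nat.divisorsAntidiagonal d, (if y.1 ≤ U then (((μ y.1 : ℤ)) : ℝ) else 0) * (if y.2 ≤ U then Λ y.2 else 0))) = 0 := by
  have h1 : ¬ d ≤ U := by intro h; nlinarith
  rw [if_neg h1, zero_mul, c0_eq_zero_of_lt hd, sub_zero]

/-- `|Λ_II(n)| ≤ τ(n) log n`. [folklore] -/
theorem abs_typeII_le (U n : ℕ) : |(∑ y ∈ Nat.divisorsAntidiagonal n, (if U < y.1 then (((μ y.1 : ℤ)) : ℝ) else 0) * (∑ c ∈ Nat.divisors y.2, if U < c then Λ c else 0))| ≤ (n.divisors.card : ℝ) * Real.log n := by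
  rcases Nat.eq_zero_or_pos n with rfl | hn
  · simp
  refine (Finset.abs_sum_le_sum_abs _ _).trans ?_
  have hcard : (Nat.divisorsAntidiagonal n).card = n.divisors.card := by
    rw [← Nat.map_div_right_divisors, Finset.card_map]
  rw [← hcard, ← nsmul_eq_mul, ← Finset.sum_const]
  refine Finset.sum_le_sum fun y hy => ?_
  obtain ⟨hy1, -⟩ := Nat.mem_divisorsAntidiagonal.mp hy
  have hy2 : 1 ≤ y.2 := Nat.pos_of_ne_zero (Nat.right_ne_zero_of_mem_divisorsAntidiagonal hy)
  have hy2n : (y.2 : ℝ) ≤ n := by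
    exact_mod_cast Nat.le_of_dvd hn ⟨y.1, by rw [mul_comm]; exact hy1.symm⟩
  rw [abs_mul]
  have hμ : |(if U < y.1 then (((μ y.1 : ℤ)) : ℝ) else 0)| ≤ 1 := by
    split_ifs
    · exact_mod_cast abs_moebius_le_one
    · simp
  calc _ ≤ 1 * |(∑ c ∈ Nat.divisors y.2, if U < c then Λ c else 0)| := mul_le_mul_of_nonneg_right hμ (abs_nonneg _)
    _ = (∑ c ∈ Nat.divisors y.2, if U < c then Λ c else 0) := by rw [one_mul, abs_of_nonneg (lamU_nonneg U y.2)]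
    _ ≤ Real.log y.2 := lamU_le_log U y.2
    _ ≤ Real.log n := Real.log_le_log (by exact_mod_cast hy2) hy2n

/-- `|Λ_I(n)| ≤ (1 + τ(n)) log n` for `n > U` (from `Λ = Λ_I + Λ_II`, `0 ≤ Λ ≤ log`). [folklore] -/
theorem abs_typeI_le (U n : ℕ) (hn : U < n) :
    |(∑ d ∈ Nat.divisors n, ((if d ≤ U then (((μ d : ℤ)) : ℝ) else 0) * Real.log (((n / d : ℕ)) : ℝ) - (∑ y ∈ Nat.divisorsAntidiagonal d, (if y.1 ≤ U then (((μ y.1 : ℤ)) : ℝ) else 0) * (if y.2 ≤ U then Λ y.2 else 0))))| ≤ (1 + (n.divisors.card : ℝ)) * Real.log n := by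
  have hV := vonMangoldt_eq_typeI_add_typeII U n hn
  have hII := abs_typeII_le U n
  have hΛ0 : 0 ≤ Λ n := vonMangoldt_nonneg
  have hΛ1 : Λ n ≤ Real.log n := vonMangoldt_le_log
  have hlog : 0 ≤ Real.log n := Real.log_natCast_nonneg n
  rw [abs_le] at hII ⊢
  constructor <;> nlinarith [hII.1, hII.2]

/-! ### The generic expansion of a convolution against a weight -/

/-- A divisor-antidiagonal sum as a double sum over a square with an indicator
(`Nat.divisorsAntidiagonal_eq_prod_filter_of_le`). [folklore] -/
theorem sum_antidiagonal_eq_sum_sum_ite {β : Type*} [AddCommMonoid β] (ψ : ℕ → ℕ → β) {Q t : ℕ}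
    (hQ0 : Q ≠ 0) (hQt : Q ≤ t) :
    ∑ y ∈ Nat.divisorsAntidiagonal Q, ψ y.1 y.2 =
      ∑ d ∈ Ioc 0 t, ∑ n ∈ Ioc 0 t, if d * n = Q then ψ d n else 0 := by
  rw [Nat.divisorsAntidiagonal_eq_prod_filter_of_le hQ0 hQt, Finset.sum_filter,
    ← Finset.sum_product']

/-- **Generic expansion.** For `ψ : ℕ → ℕ → ℂ` and `F : ℕ → ℂ`,
`Σ_{Q ∈ (P,t], Q ≡ 1 (4)} (Σ_{dn = Q} ψ(d,n)) · F(Q) = Σ_{d ≤ t} Σ_{n ≤ t} [P < dn ≤ t ∧ dn ≡ 1 (4)] ψ(d,n) F(dn)`.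
[folklore] -/
theorem sum_antidiagonal_mul_eq (ψ : ℕ → ℕ → ℂ) (F : ℕ → ℂ) (P t : ℕ) :
    ∑ Q ∈ (Ioc P t).filter (fun Q : ℕ => Q % 4 = 1),
        (∑ y ∈ Nat.divisorsAntidiagonal Q, ψ y.1 y.2) * F Q =
      ∑ d ∈ Ioc 0 t, ∑ n ∈ Ioc 0 t,
        if (P < d * n ∧ d * n ≤ t) ∧ (d * n) % 4 = 1 then ψ d n * F (d * n) else 0 := by
  have hstep : ∀ Q ∈ (Ioc P t).filter (fun Q : ℕ => Q % 4 = 1),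
      (∑ y ∈ Nat.divisorsAntidiagonal Q, ψ y.1 y.2) * F Q =
        ∑ d ∈ Ioc 0 t, ∑ n ∈ Ioc 0 t, if d * n = Q then ψ d n * F Q else 0 := by
    intro Q hQ
    have hQ' := Finset.mem_Ioc.mp (Finset.mem_filter.mp hQ).1
    rw [sum_antidiagonal_eq_sum_sum_ite ψ (by omega) hQ'.2, Finset.sum_mul]
    refine Finset.sum_congr rfl fun d _ => ?_
    rw [Finset.sum_mul]
    refine Finset.sum_congr rfl fun n _ => ?_
    split_ifs <;> simp
  rw [Finset.sum_congr rfl hstep, Finset.sum_comm]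
  refine Finset.sum_congr rfl fun d _ => ?_
  rw [Finset.sum_comm]
  refine Finset.sum_congr rfl fun n _ => ?_
  rw [Finset.sum_ite_eq]
  refine if_congr ?_ rfl rfl
  rw [Finset.mem_filter, Finset.mem_Ioc]

/-! ### The three-piece decomposition of the `Λ ⊗ Λ` bilinear form -/

/-- **`B(Λ ⊗ Λ) = B(Λ_II ⊗ Λ) + B(Λ_I ⊗ Λ_II) + B(Λ_I ⊗ Λ_I)`** for a kernel `K` on a box whose sides
start above `U` (so that Vaughan's identity applies to both variables); pure algebra. [folklore] -/
theorem bilinear_vonMangoldt_decomposition (U : ℕ) (K : ℕ → ℕ → ℂ) (S S' : Finset ℕ)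
    (hS : ∀ Q ∈ S, U < Q) (hS' : ∀ Q' ∈ S', U < Q') :
    ∑ Q ∈ S, ∑ Q' ∈ S', ((Λ Q : ℝ) : ℂ) * ((Λ Q' : ℝ) : ℂ) * K Q Q' =
      (∑ Q ∈ S, (((∑ y ∈ Nat.divisorsAntidiagonal Q, (if U < y.1 then (((μ y.1 : ℤ)) : ℝ) else 0) * (∑ c ∈ Nat.divisors y.2, if U < c then Λ c else 0)) : ℝ) : ℂ) * ∑ Q' ∈ S', ((Λ Q' : ℝ) : ℂ) * K Q Q') +
      (∑ Q' ∈ S', (((∑ y ∈ Nat.divisorsAntidiagonal Q', (if U < y.1 then (((μ y.1 : ℤ)) : ℝ) else 0) * (∑ c ∈ Nat.divisors y.2, if U < c then Λ c else 0)) : ℝ) : ℂ) * ∑ Q ∈ S, (((∑ d ∈ Nat.divisors Q, ((if d ≤ U then (((μ d : ℤ)) : ℝ) else 0) * Real.log (((Q / d : ℕ)) : ℝ) - (∑ y ∈ Nat.divisorsAntidiagonal d, (if y.1 ≤ U then (((μ y.1 : ℤ)) : ℝ) else 0) * (if y.2 ≤ U then Λ y.2 else 0)))) : ℝ) : ℂ)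 * K Q Q') +
      (∑ Q ∈ S, ∑ Q' ∈ S', (((∑ d ∈ Nat.divisors Q, ((if d ≤ U then (((μ d : ℤ)) : ℝ) else 0) * Real.log (((Q / d : ℕ)) : ℝ) - (∑ y ∈ Nat.divisorsAntidiagonal d, (if y.1 ≤ U then (((μ y.1 : ℤ)) : ℝ) else 0) * (if y.2 ≤ U then Λ y.2 else 0)))) : ℝ) : ℂ) * (((∑ d ∈ Nat.divisors Q', ((if d ≤ U then (((μ d : ℤ)) : ℝ) else 0) * Real.log (((Q' / d : ℕ)) : ℝ) - (∑ y ∈ Nat.divisorsAntidiagonal d, (if y.1 ≤ U then (((μ y.1 : ℤ)) : ℝ) else 0) * (if y.2 ≤ U then Λ y.2 else 0)))) : ℝ) : ℂ) * K Q Q') := by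
  -- abbreviations for the real-valued pieces
  set fI : ℕ → ℝ := fun Q => (∑ d ∈ Nat.divisors Q, ((if d ≤ U then (((μ d : ℤ)) : ℝ) else 0) * Real.log (((Q / d : ℕ)) : ℝ) - (∑ y ∈ Nat.divisorsAntidiagonal d, (if y.1 ≤ U then (((μ y.1 : ℤ)) : ℝ) else 0) * (if y.2 ≤ U then Λ y.2 else 0)))) with hfI
  set fII : ℕ → ℝ := fun Q => (∑ y ∈ Nat.divisorsAntidiagonal Q, (if U < y.1 then (((μ y.1 : ℤ)) : ℝ) else 0) * (∑ c ∈ Nat.divisors y.2, if U < c then Λ c else 0)) with hfII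
  have hV : ∀ Q, U < Q → (Λ Q : ℝ) = fI Q + fII Q := fun Q hQ => by
    rw [hfI, hfII]; exact vonMangoldt_eq_typeI_add_typeII U Q hQ
  -- rewrite `Λ Q` and `Λ Q'` inside the sums
  have hL : ∑ Q ∈ S, ∑ Q' ∈ S', ((Λ Q : ℝ) : ℂ) * ((Λ Q' : ℝ) : ℂ) * K Q Q' =
      ∑ Q ∈ S, ∑ Q' ∈ S', ((fI Q : ℂ) + fII Q) * ((fI Q' : ℂ) + fII Q') * K Q Q' := by
    refine Finset.sum_congr rfl fun Q hQ => Finset.sum_congr rfl fun Q' hQ' => ?_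
    rw [hV Q (hS Q hQ), hV Q' (hS' Q' hQ')]
    push_cast
    ring
  rw [hL]
  -- expand: (I + II)(I' + II') = II·(I' + II') + I·II' + I·I'
  have hsplit : ∀ Q ∈ S, ∀ Q' ∈ S',
      ((fI Q : ℂ) + fII Q) * ((fI Q' : ℂ) + fII Q') * K Q Q' =
        (fII Q : ℂ) * (((Λ Q' : ℝ) : ℂ) * K Q Q') + (fII Q' : ℂ) * ((fI Q : ℂ) * K Q Q') +
          (fI Q : ℂ) * (fI Q' : ℂ) * K Q Q' := by
    intro Q _ Q' hQ'
    rw [hV Q' (hS' Q' hQ')]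
    push_cast
    ring
  rw [Finset.sum_congr rfl fun Q hQ => Finset.sum_congr rfl fun Q' hQ' => hsplit Q hQ Q' hQ']
  simp only [Finset.sum_add_distrib]
  congr 1
  congr 1
  · exact Finset.sum_congr rfl fun Q _ => (Finset.mul_sum _ _ _).symm
  · rw [Finset.sum_comm]
    exact Finset.sum_congr rfl fun Q' _ => (Finset.mul_sum _ _ _).symm

end Summit.Parity.BatemanHorn.Cruxes.SplitBlockJacobiCorner.Sketch.MbbOfBoxInputs

namespace Summit.Parity.BatemanHorn.Cruxes.SplitBlockJacobiCorner.Sketch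

/-- **Registered stub form** (`λ_U(r) ≤ log r`, the unit bound on the Type II coefficient): restated in
`∀`-form in the crux-line namespace under the name registered on stmt-Parity-15002. [folklore] -/
theorem mbbVaughan_lamU_le_log :
    ∀ U r : ℕ, (∑ c ∈ Nat.divisors r, if U < c then ArithmeticFunction.vonMangoldt c else 0) ≤ Real.log r :=
  fun U r => MbbOfBoxInputs.lamU_le_log U r

end Summit.Parity.BatemanHorn.Cruxes.SplitBlockJacobiCorner.Sketch

end
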